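import Literature.NumberTheory.Automorphic.PadicEmbeddingCoefficientRing
import Mathlib.RingTheory.AdicCompletion.Noetherian
import Mathlib.Analysis.SpecificLimits.Basic
import HarnessLib

/-!
# `𝒪 ⊆ ℚ_p(τ(F) : τ)` and its finite free modules are `p`-adically complete

Topic `NumberTheory/Automorphic`; namespace `Literature.NumberTheory.Automorphic`; theorems and
instances only, continuing `PadicEmbeddingCoefficientRing`.  The completeness hypotheses of the
finiteness-by-Nakayama chain (`GroupCohomologyAdicNakayama`, `LevelActionCohomologyFinite`:
`IsPrecomplete (Ideal.span {ϖ}) R`, `IsAdicComplete (Ideal.span {ϖ}) V`) for the coefficient ring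
`R = 𝒪 = padicEmbInt F p` and `ϖ = p`:

* generic: `IsPrecomplete.of_linearEquiv`, `IsPrecomplete.pi_of_fintype` (finite products),
  `isPrecomplete_of_free_finite` — an `I`-adically precomplete ring has `I`-adically precomplete
  finite free modules ([Matsumura1987, §8, Thm 8.7 ff.] for the general finite case; here only the
  free case, componentwise);
* `mem_span_prime_pow_iff_norm_le` — `x ∈ p^n 𝒪 ↔ ‖x‖ ≤ ‖p‖^n` (`𝒪` is the unit ball);
* **`isPrecomplete_padicEmbInt`, `isAdicComplete_padicEmbInt`** — `𝒪` is `p`-adically complete: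
  a `p`-adic Cauchy sequence is norm-Cauchy in the complete field `E₀` (`cauchySeq_of_le_geometric`)
  and its limit lies in the closed unit ball; separatedness from `IsHausdorff.of_isDomain`;
* **`isAdicComplete_of_free_finite_padicEmbInt`** — every finite free `𝒪`-module is `p`-adically
  complete (`IsHausdorff.of_isLocalRing` for separatedness).

## References

* H. Matsumura, *Commutative Ring Theory* (1986), §8 (completion; Thm 8.7, 8.12) (held).
  [Matsumura1987]
* J.-P. Serre, *Local Fields*, GTM 67, Ch. II §1–2. [SerreLocalFields1979]
-/

noncomputable section

open Filter Topology NumberField Literature.NumberTheory.GaloisRepresentations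

namespace Literature.NumberTheory.Automorphic

/-! ### Generic: precompleteness of finite free modules -/

section Generic

variable {R : Type*} [CommRing R] (I : Ideal R) {M N : Type*} [AddCommGroup M] [Module R M]
  [AddCommGroup N] [Module R N]

/-- A linear map sends `J • ⊤` into `J • ⊤`. [folklore] -/
theorem map_smul_top_le (J : Ideal R) (g : M →ₗ[R] N) :
    (J • (⊤ : Submodule R M)).map g ≤ J • (⊤ : Submodule R N) := by
  rw [Submodule.map_smul'']
  exact Submodule.smul_mono le_rfl le_top

/-- `SModEq` modulo `J • ⊤` is preserved by linear maps. [folklore] -/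
theorem smodEq_smul_top_map {J : Ideal R} (g : M →ₗ[R] N) {x y : M}
    (h : x ≡ y [SMOD (J • (⊤ : Submodule R M))]) : g x ≡ g y [SMOD (J • (⊤ : Submodule R N))] := by
  rw [SModEq.sub_mem] at h ⊢
  rw [← map_sub]
  exact map_smul_top_le J g ⟨_, h, rfl⟩

/-- **Precompleteness passes along linear equivalences.** [folklore] -/
theorem IsPrecomplete.of_linearEquiv (e : M ≃ₗ[R] N) [IsPrecomplete I M] : IsPrecomplete I N := by
  refine ⟨fun {f} hf => ?_⟩
  obtain ⟨L, hL⟩ := IsPrecomplete.prec (inferInstance : IsPrecomplete I M) (f := fun n => e.symm (f n))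
    (fun {m n} hmn => smodEq_smul_top_map (e.symm : N →ₗ[R] M) (hf hmn))
  refine ⟨e L, fun n => ?_⟩
  have h := smodEq_smul_top_map (e : M →ₗ[R] N) (hL n)
  simpa using h

/-- **Finite products of precomplete modules are precomplete** (componentwise limits). [folklore] -/
theorem IsPrecomplete.pi_of_fintype {ι : Type*} [Fintype ι] [DecidableEq ι] [IsPrecomplete I R] :
    IsPrecomplete I (ι → R) := by
  refine ⟨fun {f} hf => ?_⟩
  -- componentwise limits
  have hcomp : ∀ i, ∃ L : R, ∀ n, f n i ≡ L [SMOD (I ^ n • (⊤ : Submodule R R))] := fun i =>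
    IsPrecomplete.prec (inferInstance : IsPrecomplete I R) (f := fun n => f n i)
      (fun {m n} hmn => smodEq_smul_top_map (LinearMap.proj i : (ι → R) →ₗ[R] R) (hf hmn))
  choose L hL using hcomp
  refine ⟨L, fun n => ?_⟩
  rw [SModEq.sub_mem]
  have hdecomp : f n - L = ∑ i, Pi.single i ((f n - L) i) := (Finset.univ_sum_single _).symm
  rw [hdecomp]
  refine Submodule.sum_mem _ fun i _ => ?_
  have hi : (f n - L) i ∈ I ^ n • (⊤ : Submodule R R) := by
    have h := hL i n
    rw [SModEq.sub_mem] at h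
    exact h
  have h := map_smul_top_le (I ^ n) (LinearMap.single R (fun _ : ι => R) i) ⟨_, hi, rfl⟩
  simpa using h

/-- **A finite free module over an `I`-adically precomplete ring is `I`-adically precomplete.**
[cite: Matsumura1987, §8, Thm 8.7] -/
theorem isPrecomplete_of_free_finite [IsPrecomplete I R] [Module.Free R M] [Module.Finite R M] :
    IsPrecomplete I M := by
  classical
  haveI : IsPrecomplete I (Module.Free.ChooseBasisIndex R M → R) := IsPrecomplete.pi_of_fintype I
  exact IsPrecomplete.of_linearEquiv I
    ((Module.Free.chooseBasis R M).repr.trans (Finsupp.linearEquivFunOnFinite R R _)).symm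

end Generic

/-! ### `𝒪` is `p`-adically complete -/

open ParallelWeight

variable (F : Type) [Field F] [NumberField F] (p : ℕ) [Fact p.Prime]

/-- `‖p‖ = p⁻¹` in `E₀`. [folklore] -/
theorem norm_natCast_prime_padicEmbField : ‖((p : ℕ) : padicEmbField F p)‖ = (p : ℝ)⁻¹ := by
  rw [PadicAlgCl.norm_coe]
  push_cast
  rw [← map_natCast (algebraMap ℚ_[p] (PadicAlgCl p)), PadicAlgCl.norm_extends, Padic.norm_p]

/-- `0 < ‖p‖ < 1` in `E₀`. [folklore] -/
theorem norm_natCast_prime_padicEmbField_lt_one : ‖((p : ℕ) : padicEmbField F p)‖ < 1 := by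
  rw [norm_natCast_prime_padicEmbField]
  exact inv_lt_one_of_one_lt₀ (by exact_mod_cast (Fact.out : p.Prime).one_lt)

/-- `0 < ‖p‖` in `E₀`. [folklore] -/
theorem norm_natCast_prime_padicEmbField_pos : 0 < ‖((p : ℕ) : padicEmbField F p)‖ := by
  rw [norm_natCast_prime_padicEmbField]
  exact inv_pos.2 (by exact_mod_cast (Fact.out : p.Prime).pos)

/-- **`x ∈ p^n 𝒪 ↔ ‖x‖ ≤ ‖p‖^n`** (`𝒪` is the closed unit ball of `E₀`). [folklore] -/
theorem mem_span_prime_pow_iff_norm_le (n : ℕ) (x : padicEmbInt F p) :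
    x ∈ Ideal.span {((p : ℕ) : padicEmbInt F p) ^ n} ↔
      ‖(x : padicEmbField F p)‖ ≤ ‖((p : ℕ) : padicEmbField F p)‖ ^ n := by
  have hp0 : ((p : ℕ) : padicEmbField F p) ^ n ≠ 0 :=
    pow_ne_zero n (norm_pos_iff.1 (norm_natCast_prime_padicEmbField_pos F p))
  constructor
  · intro h
    obtain ⟨c, rfl⟩ := Ideal.mem_span_singleton'.1 h
    push_cast
    rw [norm_mul, norm_pow]
    refine mul_le_of_le_one_left (pow_nonneg (norm_nonneg _) n) ?_
    rw [PadicAlgCl.norm_coe]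
    exact (PadicAlgCl.mem_unitBall_iff _ _).1 c.2
  · intro h
    have hy : (x : padicEmbField F p) / ((p : ℕ) : padicEmbField F p) ^ n ∈ padicEmbInt F p := by
      rw [PadicAlgCl.mem_unitBall_iff, ← PadicAlgCl.norm_coe, norm_div, norm_pow,
        div_le_one (pow_pos (norm_natCast_prime_padicEmbField_pos F p) n)]
      exact h
    refine Ideal.mem_span_singleton'.2 ⟨⟨_, hy⟩, Subtype.ext ?_⟩
    push_cast
    exact div_mul_cancel₀ _ hp0

/-- `(p)^n • ⊤ = (p^n)` in `𝒪`. [folklore] -/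
theorem span_prime_pow_smul_top (n : ℕ) :
    (Ideal.span {((p : ℕ) : padicEmbInt F p)}) ^ n • (⊤ : Submodule (padicEmbInt F p) (padicEmbInt F p)) =
      (Ideal.span {((p : ℕ) : padicEmbInt F p) ^ n}).restrictScalars (padicEmbInt F p) := by
  rw [Ideal.span_singleton_pow, smul_eq_mul, Ideal.mul_top]
  rfl

/-- **`𝒪` is `p`-adically precomplete**: a `p`-adic Cauchy sequence converges in the complete
field `E₀` and the limit lies in the closed unit ball. [cite: SerreLocalFields1979, Ch. II §1] -/
instance isPrecomplete_padicEmbInt :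
    IsPrecomplete (Ideal.span {((p : ℕ) : padicEmbInt F p)}) (padicEmbInt F p) := by
  refine ⟨fun {f} hf => ?_⟩
  have hdist : ∀ {m n : ℕ}, m ≤ n →
      ‖(f m : padicEmbField F p) - (f n : padicEmbField F p)‖ ≤ ‖((p : ℕ) : padicEmbField F p)‖ ^ m := by
    intro m n hmn
    have h := hf hmn
    rw [SModEq.sub_mem, span_prime_pow_smul_top, Submodule.restrictScalars_mem,
      mem_span_prime_pow_iff_norm_le] at h
    push_cast at h
    exact h
  have hcauchy : CauchySeq fun n => (f n : padicEmbField F p) :=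
    cauchySeq_of_le_geometric _ 1 (norm_natCast_prime_padicEmbField_lt_one F p) fun n => by
      rw [dist_eq_norm, one_mul]
      exact hdist (Nat.le_succ n)
  obtain ⟨L, hL⟩ := cauchySeq_tendsto_of_complete hcauchy
  have hL1 : L ∈ padicEmbInt F p := by
    rw [PadicAlgCl.mem_unitBall_iff, ← PadicAlgCl.norm_coe]
    refine le_of_tendsto' ((continuous_norm.tendsto L).comp hL) fun n => ?_
    change ‖(f n : padicEmbField F p)‖ ≤ 1
    rw [PadicAlgCl.norm_coe]
    exact (PadicAlgCl.mem_unitBall_iff _ _).1 (f n).2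
  refine ⟨⟨L, hL1⟩, fun m => ?_⟩
  rw [SModEq.sub_mem, span_prime_pow_smul_top, Submodule.restrictScalars_mem, mem_span_prime_pow_iff_norm_le]
  push_cast
  have ht : Tendsto (fun n => ‖(f m : padicEmbField F p) - (f n : padicEmbField F p)‖) atTop
      (𝓝 ‖(f m : padicEmbField F p) - L‖) :=
    (tendsto_const_nhds.sub hL).norm
  exact le_of_tendsto ht (Filter.eventually_atTop.2 ⟨m, fun n hn => hdist hn⟩)

/-- `(p) ≠ 𝒪` (`‖p‖ < 1`). [folklore] -/
theorem span_prime_ne_top : Ideal.span {((p : ℕ) : padicEmbInt F p)} ≠ ⊤ := by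
  rw [Ne, Ideal.span_singleton_eq_top]
  intro hu
  have h := PadicAlgCl.norm_eq_one_of_isUnit (padicEmbField F p) hu
  have h' : ‖((p : ℕ) : padicEmbField F p)‖ = 1 := by
    rw [PadicAlgCl.norm_coe]
    push_cast at h ⊢
    exact h
  exact (norm_natCast_prime_padicEmbField_lt_one F p).ne h'

/-- **`𝒪` is `p`-adically complete.** [cite: SerreLocalFields1979, Ch. II §1] -/
instance isAdicComplete_padicEmbInt :
    IsAdicComplete (Ideal.span {((p : ℕ) : padicEmbInt F p)}) (padicEmbInt F p) :=
  { IsHausdorff.of_isDomain _ (span_prime_ne_top F p), isPrecomplete_padicEmbInt F p with }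

/-- **Finite free `𝒪`-modules are `p`-adically complete** (the coefficient lattices of Hida
theory). [cite: Matsumura1987, §8, Thm 8.7] -/
theorem isAdicComplete_of_free_finite_padicEmbInt (V : Type*) [AddCommGroup V] [Module (padicEmbInt F p) V]
    [Module.Free (padicEmbInt F p) V] [Module.Finite (padicEmbInt F p) V] :
    IsAdicComplete (Ideal.span {((p : ℕ) : padicEmbInt F p)}) V :=
  { IsHausdorff.of_isLocalRing _ V (span_prime_ne_top F p), isPrecomplete_of_free_finite _ with }

end Literature.NumberTheory.Automorphic
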